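import Mathlib
import Literature.Topology.FourManifolds.PlanarAchiralWords
import Summits.SmoothPoincare4.SmoothPoincare4.Theorems.ConvexBisectionPlanarAcyclicBisectionRigidityStubWalkLow
import Summits.SmoothPoincare4.SmoothPoincare4.Theorems.ConvexBisectionPlanarAcyclicBisectionRigidityStubWalkLowDouble
import Summits.SmoothPoincare4.SmoothPoincare4.Theorems.ConvexBisectionPlanarAcyclicBisectionRigidityHelperReachMon
import HarnessLib

/-!
# Crux `ConvexBisection.PlanarAcyclicBisectionRigidity`, line Sketch — helper `helper_walkLow_level3`

The low walk (`n ≤ 2` letters) re-cut to exit at LEVEL EXACTLY `3` (page `Σ_{0,4}`), where the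
honest double is absorbed by Oba's theorem + Mazur.  Pure bookkeeping over the definitions of
`Literature/Topology/FourManifolds/PlanarAchiralWords.lean`, reusing the landed sub-namespaces
`WalkLow` (classification of in-range twists on two holes, `twist_below`, `hurwitz_twist`) and
`ReachMon` (the injective level embedding `lift` with `evalWord_succ`):

* the `n = 0, 1, 2` case split of the landed `stub_walkLowDouble` is re-run keeping track that the
  reached blocks are still in range (a Hurwitz move prepends an in-range twist word to an in-range
  carrier: `WalkLevel3.inRange_hurwitzAct`, `WalkLevel3.walk_low_inRange`);
* one PLANAR STABILISATION STEP (`WalkLevel3.stabilize_step`): from an in-range block form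
  `A · B̄ʳᵉᵛ` at level `m`, rotate the positive block to the back, stabilise with the round curve
  `γ = c_[m,m]` about the new hole (`Move.stabilize m m []`), and rotate back — the reached word is
  literally the block form of `(A ++ [γ], B ++ [γ])` at level `m + 1`, again in range, and `TwistEq`
  persists because the arc data of an in-range twist at level `m + 1` is the level embedding of
  its arc data at level `m` (`ReachMon.evalWord_succ`);
* the step is iterated `3 − n` times (`WalkLevel3.climb`).
-/

noncomputable section

open Literature.Topology.FourManifolds Literature.Topology.FourManifolds.PlanarWords

-- the prescribed namespace `Summit.<S>.<P>.…` repeats `SmoothPoincare4` (S = P = SmoothPoincare4)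
set_option linter.dupNamespace false

namespace Summit.SmoothPoincare4.SmoothPoincare4.Theorems.PlanarAcyclicBisectionRigidity.Sketch

namespace WalkLevel3

open ArcData WalkLow

/-! ## Reachability plumbing: transitivity and cyclic rotation of a word -/

/-- Reachability is transitive (it is a reflexive-transitive closure). [folklore] -/
theorem reach_trans {s t u : ℕ × List Letter} (h₁ : Reachable s t) (h₂ : Reachable t u) :
    Reachable s u :=
  Relation.ReflTransGen.trans h₁ h₂

/-- Cyclic rotation: `u · v` walks to `v · u` by `|u|` rotation moves. [folklore] -/
theorem reach_rotate (m : ℕ) (u v : List Letter) : Reachable (m, u ++ v) (m, v ++ u) := by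
  induction u generalizing v with
  | nil => simpa using Reachable.refl (m, v)
  | cons l u ih =>
    have h1 : Reachable (m, l :: (u ++ v)) (m, u ++ (v ++ [l])) := by
      have h := Move.reachable (Move.rotate m l (u ++ v))
      rwa [List.append_assoc] at h
    have h2 : Reachable (m, u ++ (v ++ [l])) (m, (v ++ [l]) ++ u) := ih (v ++ [l])
    rw [List.append_assoc, List.singleton_append] at h2
    rw [List.cons_append]
    exact reach_trans h1 h2

/-! ## In-range bookkeeping -/

/-- The support condition is monotone in the level. [folklore] -/
theorem below_succ {m : ℕ} {x : PGen} (hx : x.below m = true) : x.below (m + 1) = true := by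
  cases x <;> simp only [PGen.below, decide_eq_true_eq] at hx ⊢ <;> omega

/-- An in-range curve stays in range one level up. [folklore] -/
theorem inRange_succ {m : ℕ} {c : PlanarCurve} (hc : c.InRange m) : c.InRange (m + 1) := by
  obtain ⟨hab, hb, hg⟩ := hc
  exact ⟨hab, Nat.lt_succ_of_lt hb, fun x hx => below_succ (hg x hx)⟩

/-- The stabilising round curve `c_[m,m]` about the new hole `m` is in range at level `m + 1`.
[folklore] -/
theorem inRange_gamma (m : ℕ) : (⟨m, m, []⟩ : PlanarCurve).InRange (m + 1) :=
  ⟨le_rfl, Nat.lt_succ_self m, fun x hx => by simp at hx⟩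

/-- The Hurwitz image of an in-range letter by an in-range letter is in range (the twist word of an
in-range curve is supported below the level, `WalkLow.twist_below`). [folklore] -/
theorem inRange_hurwitzAct {m : ℕ} {x y : Letter} (hx : x.1.InRange m) (hy : y.1.InRange m) :
    (hurwitzAct x y).1.InRange m := by
  obtain ⟨hab, hb, hg⟩ := hy
  refine ⟨hab, hb, fun z hz => ?_⟩
  simp only [hurwitzAct, PlanarCurve.image, Letter.twistWord, List.mem_append] at hz
  rcases hz with hz | hz
  · exact twist_below hx _ z hz
  · exact hg z hz

/-- The letters of a block form are in range when the curves of both blocks are. [folklore] -/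
theorem blockLetters_inRange {m : ℕ} {A B : List PlanarCurve} (hAB : ∀ c ∈ A ++ B, c.InRange m) :
    ∀ l ∈ (B.map fun c => (c, false)).reverse ++ positiveWord A, l.1.InRange m := by
  intro l hl
  simp only [positiveWord, List.mem_append, List.mem_reverse, List.mem_map] at hl
  rcases hl with ⟨c, hc, rfl⟩ | ⟨c, hc, rfl⟩
  · exact hAB c (List.mem_append_right A hc)
  · exact hAB c (List.mem_append_left B hc)

/-! ## `TwistEq` persists one level up for in-range blocks -/

/-- Equal positive twists of in-range curves at level `m` are equal at level `m + 1`: both are the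
level embedding `ReachMon.lift` of the level-`m` arc data (`ReachMon.evalWord_succ`). [folklore] -/
theorem twistEq_succ {m : ℕ} {A B : List PlanarCurve} (hA : ∀ c ∈ A, c.InRange m)
    (hB : ∀ c ∈ B, c.InRange m) (ht : TwistEq m A B) : TwistEq (m + 1) A B := by
  unfold TwistEq at ht ⊢
  induction ht with
  | nil => exact List.Forall₂.nil
  | @cons c d A B hcd _ ih =>
    refine List.Forall₂.cons ?_ (ih (fun x hx => hA x (List.mem_cons_of_mem c hx))
      (fun x hx => hB x (List.mem_cons_of_mem d hx)))
    rw [ReachMon.evalWord_succ _ (twist_below (hA c List.mem_cons_self) true),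
      ReachMon.evalWord_succ _ (twist_below (hB d List.mem_cons_self) true), hcd]

/-! ## One planar stabilisation step in block form -/

/-- The block form of `(A ++ [γ], B ++ [γ])` is `A⁺ · γ⁺ · γ⁻ · B̄ʳᵉᵛ` (list identity). [folklore] -/
theorem blockForm_snoc (A B : List PlanarCurve) (γ : PlanarCurve) :
    blockForm (A ++ [γ]) (B ++ [γ])
      = positiveWord A ++ ((γ, true) :: (γ, false) :: (B.map fun c => (c, false)).reverse) := by
  simp [blockForm, positiveWord]

/-- THE STABILISATION WALK: from an in-range block form `A · B̄ʳᵉᵛ` at level `m`, rotate `|A|` times,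
stabilise with `γ = c_[m,m]` about the new hole, rotate `2 + |B|` times: the block form of
`(A ++ [γ], B ++ [γ])` at level `m + 1`. [folklore] -/
theorem stabilize_reach (m : ℕ) (A B : List PlanarCurve) (hAB : ∀ c ∈ A ++ B, c.InRange m) :
    Reachable (m, blockForm A B) (m + 1, blockForm (A ++ [⟨m, m, []⟩]) (B ++ [⟨m, m, []⟩])) := by
  have h1 : Reachable (m, blockForm A B) (m, (B.map fun c => (c, false)).reverse ++ positiveWord A) :=
    reach_rotate m _ _
  have h2 : Reachable (m, (B.map fun c => (c, false)).reverse ++ positiveWord A)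
      (m + 1, ((⟨m, m, []⟩, true) :: (⟨m, m, []⟩, false) :: (B.map fun c => (c, false)).reverse)
        ++ positiveWord A) :=
    Move.reachable (Move.stabilize m m [] _ le_rfl (fun x hx => by simp at hx)
      (blockLetters_inRange hAB))
  have h3 : Reachable
      (m + 1, ((⟨m, m, []⟩, true) :: (⟨m, m, []⟩, false) :: (B.map fun c => (c, false)).reverse)
        ++ positiveWord A)
      (m + 1, positiveWord A ++
        ((⟨m, m, []⟩, true) :: (⟨m, m, []⟩, false) :: (B.map fun c => (c, false)).reverse)) :=
    reach_rotate (m + 1) _ _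
  rw [blockForm_snoc]
  exact reach_trans h1 (reach_trans h2 h3)

/-- THE STABILISATION STEP with its bookkeeping: the reached blocks `(A ++ [γ], B ++ [γ])` are in
range at level `m + 1` and twist-equal there when `(A, B)` were at level `m`. [folklore] -/
theorem stabilize_step (m : ℕ) (A B : List PlanarCurve) (hAB : ∀ c ∈ A ++ B, c.InRange m)
    (ht : TwistEq m A B) :
    Reachable (m, blockForm A B) (m + 1, blockForm (A ++ [⟨m, m, []⟩]) (B ++ [⟨m, m, []⟩])) ∧
      (∀ c ∈ (A ++ [⟨m, m, []⟩]) ++ (B ++ [⟨m, m, []⟩]), c.InRange (m + 1)) ∧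
      TwistEq (m + 1) (A ++ [⟨m, m, []⟩]) (B ++ [⟨m, m, []⟩]) := by
  have hA : ∀ c ∈ A, c.InRange m := fun c hc => hAB c (List.mem_append_left B hc)
  have hB : ∀ c ∈ B, c.InRange m := fun c hc => hAB c (List.mem_append_right A hc)
  refine ⟨stabilize_reach m A B hAB, fun c hc => ?_, ?_⟩
  · simp only [List.mem_append, List.mem_singleton] at hc
    rcases hc with (hc | rfl) | (hc | rfl)
    · exact inRange_succ (hA c hc)
    · exact inRange_gamma m
    · exact inRange_succ (hB c hc)
    · exact inRange_gamma m
  · exact List.rel_append (twistEq_succ hA hB ht) (List.Forall₂.cons rfl List.Forall₂.nil)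

/-- CLIMBING `k` LEVELS: iterate the stabilisation step. [folklore] -/
theorem climb (k : ℕ) : ∀ (m : ℕ) (A B : List PlanarCurve), (∀ c ∈ A ++ B, c.InRange m) →
    TwistEq m A B → ∃ (A' B' : List PlanarCurve),
      Reachable (m, blockForm A B) (m + k, blockForm A' B') ∧ TwistEq (m + k) A' B' := by
  induction k with
  | zero => exact fun m A B _ ht => ⟨A, B, Reachable.refl _, ht⟩
  | succ k ih =>
    intro m A B hAB ht
    obtain ⟨hr, hAB', ht'⟩ := stabilize_step m A B hAB ht
    obtain ⟨A', B', hr', ht''⟩ := ih (m + 1) _ _ hAB' ht'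
    rw [show m + 1 + k = m + (k + 1) by omega] at hr' ht''
    exact ⟨A', B', reach_trans hr hr', ht''⟩

/-! ## The low walk with in-range bookkeeping (re-run of `stub_walkLowDouble`) -/

/-- The case `n = 2`, doubles only, with in-range bookkeeping: zero or one Hurwitz move reaches an
honest double whose curves are still in range on two holes. [folklore] -/
theorem walk_two_inRange (c₁ c₂ d₁ d₂ : PlanarCurve) (h₁ : c₁.InRange 2) (h₂ : c₂.InRange 2)
    (h₃ : d₁.InRange 2) (h₄ : d₂.InRange 2)
    (hmon : monodromy 2 (positiveWord [c₁, c₂]) = monodromy 2 (positiveWord [d₁, d₂])) :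
    ∃ (A' B' : List PlanarCurve),
      Reachable (2, blockForm [c₁, c₂] [d₁, d₂]) (2, blockForm A' B') ∧ TwistEq 2 A' B' ∧
        ∀ c ∈ A' ++ B', c.InRange 2 := by
  obtain ⟨t₁, ht₁⟩ := twist_classify c₁ h₁
  obtain ⟨t₂, ht₂⟩ := twist_classify c₂ h₂
  obtain ⟨s₁, hs₁⟩ := twist_classify d₁ h₃
  obtain ⟨s₂, hs₂⟩ := twist_classify d₂ h₄
  have hdeg : t₁.deg + t₂.deg = s₁.deg + s₂.deg := by
    rw [← D_R, ← D_R, ← D_R, ← D_R, ← D_mul _ _ (R_perm _ _), ← D_mul _ _ (R_perm _ _), ← ht₁, ← ht₂,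
      ← hs₁, ← hs₂, ← monodromy_two, ← monodromy_two, hmon]
  rcases Ty.key _ _ _ _ hdeg with ⟨rfl, rfl⟩ | ⟨rfl, rfl⟩
  · refine ⟨[c₁, c₂], [d₁, d₂], Reachable.refl _,
      List.Forall₂.cons (ht₁.trans hs₁.symm) (List.Forall₂.cons (ht₂.trans hs₂.symm) List.Forall₂.nil),
      fun c hc => ?_⟩
    simp only [List.cons_append, List.nil_append, List.mem_cons, List.not_mem_nil, or_false] at hc
    rcases hc with rfl | rfl | rfl | rfl <;> assumption
  · refine ⟨[c₁, c₂], [d₂, (hurwitzAct (d₂, false) (d₁, false)).1],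
      Move.reachable (Move.hurwitz 2 [(c₁, true), (c₂, true)] [] (d₂, false) (d₁, false)),
      List.Forall₂.cons (ht₁.trans hs₂.symm) (List.Forall₂.cons
        (ht₂.trans (hurwitz_twist d₁ d₂ h₄ _ _ hs₁ hs₂).symm) List.Forall₂.nil),
      fun c hc => ?_⟩
    simp only [List.cons_append, List.nil_append, List.mem_cons, List.not_mem_nil, or_false] at hc
    rcases hc with rfl | rfl | rfl | rfl
    · exact h₁
    · exact h₂
    · exact h₄
    · exact inRange_hurwitzAct h₄ h₃

/-- The low walk (`n ≤ 2`) of `stub_walkLowDouble`, level unchanged, with the extra bookkeeping that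
the reached blocks are in range at level `n`. [folklore] -/
theorem walk_low_inRange (n : ℕ) (A B : List PlanarCurve) (hw : IsIntegralSphereWord n A B)
    (hn : n ≤ 2) :
    ∃ (A' B' : List PlanarCurve),
      Reachable (n, blockForm A B) (n, blockForm A' B') ∧ TwistEq n A' B' ∧
        ∀ c ∈ A' ++ B', c.InRange n := by
  obtain ⟨hin, hA, hB, hmon, -, -, -⟩ := hw
  interval_cases n
  · obtain rfl : A = [] := List.eq_nil_of_length_eq_zero hA
    obtain rfl : B = [] := List.eq_nil_of_length_eq_zero hB
    exact ⟨[], [], Reachable.refl _, TwistEq.refl 0 [], fun c hc => by simp at hc⟩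
  · obtain ⟨a, rfl⟩ := List.length_eq_one_iff.1 hA
    obtain ⟨b, rfl⟩ := List.length_eq_one_iff.1 hB
    refine ⟨[a], [b], Reachable.refl _, List.Forall₂.cons ?_ List.Forall₂.nil, hin⟩
    simpa [monodromy, positiveWord, Letter.twistWord] using hmon
  · obtain ⟨c₁, c₂, rfl⟩ := List.length_eq_two.1 hA
    obtain ⟨d₁, d₂, rfl⟩ := List.length_eq_two.1 hB
    exact walk_two_inRange c₁ c₂ d₁ d₂ (hin c₁ (by simp)) (hin c₂ (by simp)) (hin d₁ (by simp))
      (hin d₂ (by simp)) hmon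

end WalkLevel3

/-- **Helper (wave c2-1) — the low walk re-cut to LEVEL 3.**  Every integral homotopy-sphere word
with `n ≤ 2` letters reaches an honest double AT LEVEL `3`: the landed low walk
(`stub_walkLowDouble`: at most one Hurwitz move, level unchanged, letters still in range because a
Hurwitz move prepends an in-range twist word to an in-range carrier) followed by `3 − n` planar
stabilisations `Move.stabilize` with the round curve `c_[m,m]` about the new hole (plus rotations
to restore block form), along which `TwistEq` persists (the arc data of an in-range twist at level
`m + 1` is the level embedding of its arc data at level `m`, `ReachMon.evalWord_succ`). [folklore] -/
theorem helper_walkLow_level3 (n : ℕ) (A B : List PlanarCurve) (hw : IsIntegralSphereWord n A B)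
    (hn : n ≤ 2) :
    ∃ (A' B' : List PlanarCurve),
      Reachable (n, blockForm A B) (3, blockForm A' B') ∧ TwistEq 3 A' B' := by
  obtain ⟨A₁, B₁, hr₁, ht₁, hin₁⟩ := WalkLevel3.walk_low_inRange n A B hw hn
  obtain ⟨A', B', hr, ht⟩ := WalkLevel3.climb (3 - n) n A₁ B₁ hin₁ ht₁
  rw [show n + (3 - n) = 3 by omega] at hr ht
  exact ⟨A', B', WalkLevel3.reach_trans hr₁ hr, ht⟩

end Summit.SmoothPoincare4.SmoothPoincare4.Theorems.PlanarAcyclicBisectionRigidity.Sketch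

end
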